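import Summits.QuantumFields.YangMills.Theorems.UnitScaleTiltProp7TrueLinReducedStep
import Summits.QuantumFields.YangMills.Theorems.UnitScaleTiltProp7TrueLinLineBound
import HarnessLib

/-!
# Route `UnitScaleTilt`, crux K1 «MinimiserStabilityRegPr» (stmt-QuantumFields-19200), route-R [RP] curved, the curved N6 row (R-C), second brick —
# THE ONE-STEP DEFECT `D = T(V) − P_{V̄}∘CM_V − LINE_V` OF THE REDUCED TRUE LINEARISATION IS `ℓ²`-SMALL:
# `Σ_c ‖D(c)‖² ≤ (159·(d+2)L·α)²·(2dL^d)·(2d)·Σ_b ‖Z(b)‖²` (every walk of (0.4) at `c` lives on the two blocks of `c`; `α` = size of the loop variables of `V`)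

Cell `ym3-torus`, width seat `ym-ust-20520-w2` (g3); sequel of ✓ p606243 `…TrueLinReducedStep.norm_reduced_sub_line_le` (the pointwise `159·α·m` defect, `m` a bound
of the walk masses of `Z` at `c`) and of `…TrueLinLineBound` (`LINE` bookkeeping).  THEOREMS ONLY (0 `def`, 0 `sorry`); `--supports stmt-QuantumFields-19200`,
count-neutral.  YM₃ on T³ is a ladder rung (R3), not the Clay problem; nothing here claims the curved N6 bounds, S2, P, the crux or the gap.

THE POINT (row (R-C), `ℓ²` bookkeeping of the defects).  Every walk entering the one-step operator at the coarse bond `c` — the (0.4) loops at `c`, the straight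
segment `[y, y′]`, the combs at `c₊` — issues only from sites of `B(c₋) ∪ B(c₊)` (tree `blockOf_src_of_mem_walk` for the loops; §1 for combs and the segment) and
has at most `(d+2)L` steps, so every walk mass is `≤ (d+2)L·S(c)` with `S(c) = Σ_{b : blockOf b₋ ∈ {c₋,c₊}} ‖Z(b)‖` (§2).  Cauchy–Schwarz over the `≤ 2dL^d` bonds
of that neighbourhood and the multiplicity `≤ 2d` of a bond among the neighbourhoods (§3) turn the pointwise defect of ✓ p606243 into the `ℓ²` row (§4) that the
`k`-fold propagation (next brick: `‖Δ_{j+1}‖ ≤ L^{(2−d)/2}‖Δ_j‖ + ‖D_j‖`, ✓ `sum_normSq_line_le`) consumes; with `α_j = O(εL^{2(j−k)})` geometric this is k-uniform.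

WHAT IS PROVED (ns `…Theorems.Prop7TrueLinDefectBound`).
* §1 `blockOf_src_of_mem_walk_stairWord` (combs stay in their block); the segment stays in `B(c₋) ∪ B(c₊)` (inside `mass_segment_le`; = the NE7 spine's `blockOf_src_of_mem_axWalk`, not importable here).
* §2 `mass_le_length_mul`, `mass_loop_le`, `mass_segment_le`, `mass_comb_tgt_le` — every walk mass at `c` is `≤ (d+2)L·S(c)`.
* §3 `card_filter_blockOf_src_eq` (`= d·L^d`), `card_nbhd_le` (`≤ 2dL^d`), `sum_nbhd_le` (`Σ_c Σ_{b∈N(c)} g ≤ 2d·Σ_b g` for `g ≥ 0`).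
* §4 ★ `norm_defect_le_nbhd` (pointwise: `‖D(c)‖ ≤ 159α(d+2)L·S(c)`), ★★ `sum_normSq_defect_le` (the title).
HONEST SCOPE.  One level; the defect is against THIS file's `LINE_V` (nested-comb transports), not yet against the engine's `A^{U₀}` of ✓ p601741 (transport geometry = the
remaining part of (R-C)); the `k`-fold propagation is the next brick.

References: T. Bałaban, CMP 98 (1985) 17–51 [Balaban1985Averaging] (Prop. 3 (124)–(126) p.36, (19)–(20) p.21); CMP 109 (1987) 249–301 [Balaban1987RG1] ((0.3)–(0.4) pp.252–253).
-/

noncomputable section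

open scoped BigOperators Matrix.Norms.L2Operator

namespace Summit.QuantumFields.YangMills.Theorems.Prop7TrueLinDefectBound

open Literature.MathematicalPhysics.QuantumFieldTheory.Balaban1983to89
open Finset T4Continuum BlockAveraging AveragingRT ExpMeanLog BlockAveragingEMLLinearised BlockAveragingEMLLinearisedBackground BlockAveragingEMLProp2
open LatticeWordStokes (length_loopWord_le)
open B10StarCount (sum_pbond shiftEquiv)
open Summit.QuantumFields.YangMills.Theorems.Prop7TrueLinReducedStep (norm_reduced_sub_line_le)
open Summit.QuantumFields.YangMills.Theorems.Prop7TrueLinLineBound (sum_site_eq_sum_blockSite)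

variable {P : Params} {n : Type*} [Fintype n] [DecidableEq n] [Nonempty n] {j : ℕ}

/-! ## §1 Where the walks live -/

omit [Fintype n] [DecidableEq n] [Nonempty n] in
/-- Every bond of a staircase of (0.3) from the centre of `B(y)` issues from a site of `B(y)` (prefix box `netDisp_take_stairWord`, `|n_ν| ≤ (L−1)/2`).
[cite: Balaban1987RG1, (0.3) p.252] -/
theorem blockOf_src_of_mem_walk_stairWord (hj : j + 1 ≤ P.m + P.K) (y : Site P (j + 1)) (σ : Equiv.Perm (Fin P.d)) (r : Fin P.d → Fin P.L)
    (s : LStep P j) (hs : s ∈ walk (emb y) (stairWord σ (off r))) : blockOf s.bond.src = y := by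
  obtain ⟨k, hk⟩ := exists_src_eq_walkEnd_take _ _ s hs
  refine blockOf_eq_of_near_emb hj y s.bond.src (fun κ => netDisp ((stairWord σ (off r)).take k) κ)
    (fun ν => by rw [hk, walkEnd_apply]) (fun ν => ?_)
  have h1 := netDisp_take_stairWord σ (off r) ν k
  have h2 := off_bounds r ν
  constructor
  · exact le_trans (le_min (by omega) h2.1) h1.1
  · exact h1.2.trans (max_le (by omega) h2.2)

/-! ## §2 Walk masses against the two-block neighbourhood sum `S(c)` -/

omit [Nonempty n] in
/-- A walk all of whose bonds lie in a finite set `N` has mass `≤ |walk|·Σ_{b∈N}‖Z(b)‖`. [folklore] -/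
theorem mass_le_length_mul (Z : PBond P j → Matrix n n ℂ) (N : Finset (PBond P j)) :
    ∀ w : List (LStep P j), (∀ s ∈ w, s.bond ∈ N) → (w.map fun s => ‖Z s.bond‖).sum ≤ w.length * ∑ b ∈ N, ‖Z b‖
  | [], _ => by simp
  | s :: w, hw => by
    rw [List.map_cons, List.sum_cons, List.length_cons]
    have hs : ‖Z s.bond‖ ≤ ∑ b ∈ N, ‖Z b‖ :=
      Finset.single_le_sum (f := fun b => ‖Z b‖) (fun b _ => norm_nonneg _) (hw s (List.mem_cons_self))
    have hrest := mass_le_length_mul Z N w (fun s' hs' => hw s' (List.mem_cons_of_mem _ hs'))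
    push_cast
    nlinarith

omit [Nonempty n] in
/-- The (0.4) loop walks at `c` have mass `≤ (d+2)L·S(c)`. [cite: Balaban1987RG1, (0.4) p.253] -/
theorem mass_loop_le (hj : j + 1 ≤ P.m + P.K) (Z : PBond P j → Matrix n n ℂ) (c : PBond P (j + 1)) (i : Idx P) :
    ((walk (emb c.src) (loopWord P.L c.dir (off i.1) i.2.1 i.2.2)).map fun s => ‖Z s.bond‖).sum
      ≤ (((P.d + 2) * P.L : ℕ) : ℝ) * ∑ b ∈ univ.filter (fun b : PBond P j => blockOf b.src = c.src ∨ blockOf b.src = c.tgt), ‖Z b‖ := by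
  have hmem : ∀ s ∈ walk (emb c.src) (loopWord P.L c.dir (off i.1) i.2.1 i.2.2),
      s.bond ∈ univ.filter (fun b : PBond P j => blockOf b.src = c.src ∨ blockOf b.src = c.tgt) :=
    fun s hs => Finset.mem_filter.2 ⟨Finset.mem_univ _, blockOf_src_of_mem_walk hj c i s hs⟩
  refine (mass_le_length_mul Z _ _ hmem).trans (mul_le_mul_of_nonneg_right ?_ (Finset.sum_nonneg fun b _ => norm_nonneg _))
  exact_mod_cast ((length_walk _ _).le.trans (length_loopWord_le c i))

omit [Nonempty n] in
/-- The straight segment at `c` has mass `≤ (d+2)L·S(c)`. [cite: Balaban1987RG1, (0.4) p.253] -/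
theorem mass_segment_le (hj : j + 1 ≤ P.m + P.K) (Z : PBond P j → Matrix n n ℂ) (c : PBond P (j + 1)) :
    ((walk (emb c.src) (List.replicate P.L (c.dir, true))).map fun s => ‖Z s.bond‖).sum
      ≤ (((P.d + 2) * P.L : ℕ) : ℝ) * ∑ b ∈ univ.filter (fun b : PBond P j => blockOf b.src = c.src ∨ blockOf b.src = c.tgt), ‖Z b‖ := by
  -- every bond of the segment issues from `B(c₋) ∪ B(c₊)` (first half in `B(c₋)`, second half in `B(c₊)`; cf. the NE7 spine's `blockOf_src_of_mem_axWalk`)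
  have hblk : ∀ s ∈ walk (emb c.src) (List.replicate P.L (c.dir, true)), blockOf s.bond.src = c.src ∨ blockOf s.bond.src = c.tgt := by
    intro s hs
    obtain ⟨k, hk⟩ := exists_src_eq_walkEnd_take _ _ s hs
    have hL := two_mul_half_add_one P
    rw [List.take_replicate] at hk
    set m : ℕ := min k P.L with hm
    have hmL : m ≤ P.L := min_le_right _ _
    have hdisp : ∀ κ, netDisp (List.replicate m (c.dir, true)) κ = if c.dir = κ then (m : ℤ) else 0 := by
      intro κ
      rw [T4ReflectionCone.netDisp_replicate]
      by_cases h : c.dir = κ <;> simp [h]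
    by_cases hfar : (m : ℤ) ≤ (((P.L - 1) / 2 : ℕ) : ℤ)
    · left
      refine blockOf_eq_of_near_emb hj c.src s.bond.src (fun κ => netDisp (List.replicate m (c.dir, true)) κ)
        (fun ν => by rw [hk, walkEnd_apply]) (fun ν => ?_)
      rw [hdisp]
      by_cases h : c.dir = ν
      · rw [if_pos h]; constructor <;> omega
      · rw [if_neg h]; constructor <;> omega
    · right
      refine blockOf_eq_of_near_emb hj c.tgt s.bond.src (fun κ => netDisp (List.replicate m (c.dir, true)) κ - (if κ = c.dir then (P.L : ℤ) else 0)) ?_ ?_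
      · intro ν
        rw [hk, walkEnd_apply, PBond.tgt, emb_shift_apply]
        by_cases hν : ν = c.dir
        · rw [if_pos hν, if_pos hν]; push_cast; ring
        · rw [if_neg hν, if_neg hν, add_zero, sub_zero]
      · intro ν
        rw [hdisp]
        by_cases hν : ν = c.dir
        · subst hν
          rw [if_pos rfl, if_pos rfl]
          constructor <;> omega
        · rw [if_neg (Ne.symm hν), if_neg hν, sub_zero]; constructor <;> omega
  have hmem : ∀ s ∈ walk (emb c.src) (List.replicate P.L (c.dir, true)),
      s.bond ∈ univ.filter (fun b : PBond P j => blockOf b.src = c.src ∨ blockOf b.src = c.tgt) :=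
    fun s hs => Finset.mem_filter.2 ⟨Finset.mem_univ _, hblk s hs⟩
  refine (mass_le_length_mul Z _ _ hmem).trans (mul_le_mul_of_nonneg_right ?_ (Finset.sum_nonneg fun b _ => norm_nonneg _))
  exact_mod_cast length_walk_replicate_le (emb c.src) c.dir true

omit [Nonempty n] in
/-- The combs at `c₊` have mass `≤ (d+2)L·S(c)`. [cite: Balaban1987RG1, (0.3) p.252] -/
theorem mass_comb_tgt_le (hj : j + 1 ≤ P.m + P.K) (Z : PBond P j → Matrix n n ℂ) (c : PBond P (j + 1)) (σ : Equiv.Perm (Fin P.d))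
    (r : Fin P.d → Fin P.L) :
    ((walk (emb c.tgt) (stairWord σ (off r))).map fun s => ‖Z s.bond‖).sum
      ≤ (((P.d + 2) * P.L : ℕ) : ℝ) * ∑ b ∈ univ.filter (fun b : PBond P j => blockOf b.src = c.src ∨ blockOf b.src = c.tgt), ‖Z b‖ := by
  have hmem : ∀ s ∈ walk (emb c.tgt) (stairWord σ (off r)),
      s.bond ∈ univ.filter (fun b : PBond P j => blockOf b.src = c.src ∨ blockOf b.src = c.tgt) :=
    fun s hs => Finset.mem_filter.2 ⟨Finset.mem_univ _, Or.inr (blockOf_src_of_mem_walk_stairWord hj c.tgt σ r s hs)⟩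
  refine (mass_le_length_mul Z _ _ hmem).trans (mul_le_mul_of_nonneg_right ?_ (Finset.sum_nonneg fun b _ => norm_nonneg _))
  exact_mod_cast length_walk_stairWord_le (emb c.tgt) σ r

/-! ## §3 Counting: the neighbourhood has `≤ 2dL^d` bonds and every bond lies in `≤ 2d` neighbourhoods -/

omit [Fintype n] [DecidableEq n] [Nonempty n] in
/-- `#{b : blockOf b₋ = y} = L^d·d` (standing range; `Site.blockEquiv` on the source, the direction free). [folklore] -/
theorem card_filter_blockOf_src_eq (hj : j + 1 ≤ P.m + P.K) (y : Site P (j + 1)) :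
    (univ.filter fun b : PBond P j => blockOf b.src = y).card = P.L ^ P.d * P.d := by
  rw [← Fintype.card_subtype]
  let e : {b : PBond P j // blockOf b.src = y} ≃ {x : Site P j // blockOf x = y} × Fin P.d :=
    ⟨fun b => (⟨b.1.src, b.2⟩, b.1.dir), fun p => ⟨⟨p.1.1, p.2⟩, p.1.2⟩, fun b => rfl, fun p => rfl⟩
  rw [Fintype.card_congr (e.trans ((Site.blockEquiv hj y).prodCongr (Equiv.refl _))), Fintype.card_prod, Fintype.card_fun, Fintype.card_fin,
    Fintype.card_fin]

omit [Fintype n] [DecidableEq n] [Nonempty n] in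
/-- `#N(c) ≤ 2dL^d` for `N(c) = {b : blockOf b₋ ∈ {c₋, c₊}}`. [folklore] -/
theorem card_nbhd_le (hj : j + 1 ≤ P.m + P.K) (c : PBond P (j + 1)) :
    ((univ.filter fun b : PBond P j => blockOf b.src = c.src ∨ blockOf b.src = c.tgt).card : ℝ) ≤ 2 * P.d * (P.L : ℝ) ^ P.d := by
  have h1 := card_filter_blockOf_src_eq hj c.src
  have h2 := card_filter_blockOf_src_eq hj c.tgt
  have hle : (univ.filter fun b : PBond P j => blockOf b.src = c.src ∨ blockOf b.src = c.tgt).card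
      ≤ (univ.filter fun b : PBond P j => blockOf b.src = c.src).card + (univ.filter fun b : PBond P j => blockOf b.src = c.tgt).card := by
    rw [Finset.card_filter, Finset.card_filter, Finset.card_filter, ← Finset.sum_add_distrib]
    refine Finset.sum_le_sum fun b _ => ?_
    by_cases ha : blockOf b.src = c.src <;> by_cases hb : blockOf b.src = c.tgt <;> simp [ha, hb]
  rw [h1, h2] at hle
  calc ((univ.filter fun b : PBond P j => blockOf b.src = c.src ∨ blockOf b.src = c.tgt).card : ℝ)
      ≤ ((P.L ^ P.d * P.d + P.L ^ P.d * P.d : ℕ) : ℝ) := by exact_mod_cast hle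
    _ = 2 * P.d * (P.L : ℝ) ^ P.d := by push_cast; ring

omit [Fintype n] [DecidableEq n] [Nonempty n] in
/-- `#{c : c₋ = y} = d` and `#{c : c₊ = y} = d`, as indicator sums. [folklore] -/
theorem sum_ite_src_eq (y : Site P (j + 1)) (a : ℝ) : ∑ c : PBond P (j + 1), (if c.src = y then a else 0) = P.d * a := by
  rw [sum_pbond]
  have h : ∀ x : Site P (j + 1), (∑ _μ : Fin P.d, if (⟨x, _μ⟩ : PBond P (j + 1)).src = y then a else 0) = (P.d : ℝ) * (if x = y then a else 0) := by
    intro x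
    show (∑ _μ : Fin P.d, if x = y then a else 0) = _
    rw [Finset.sum_const, Finset.card_univ, Fintype.card_fin, nsmul_eq_mul]
  rw [Finset.sum_congr rfl fun x _ => h x, ← Finset.mul_sum, Finset.sum_ite_eq' Finset.univ y, if_pos (Finset.mem_univ _)]

omit [Fintype n] [DecidableEq n] [Nonempty n] in
/-- `#{c : c₊ = y} = d`, as an indicator sum (translation invariance `shiftEquiv`). [folklore] -/
theorem sum_ite_tgt_eq (y : Site P (j + 1)) (a : ℝ) : ∑ c : PBond P (j + 1), (if c.tgt = y then a else 0) = P.d * a := by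
  rw [sum_pbond]
  have h : ∀ x : Site P (j + 1), ∀ μ : Fin P.d,
      (if (⟨x, μ⟩ : PBond P (j + 1)).tgt = y then a else 0) = (fun z : Site P (j + 1) => if z = y then a else 0) (shiftEquiv (P := P) (i := j + 1) μ x) :=
    fun x μ => rfl
  have hμ : ∀ μ : Fin P.d, (∑ x : Site P (j + 1), if (⟨x, μ⟩ : PBond P (j + 1)).tgt = y then a else 0) = a := by
    intro μ
    rw [Finset.sum_congr rfl fun x _ => h x μ, Equiv.sum_comp (shiftEquiv (P := P) (i := j + 1) μ) (fun z : Site P (j + 1) => if z = y then a else 0),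
      Finset.sum_ite_eq' Finset.univ y, if_pos (Finset.mem_univ _)]
  rw [Finset.sum_comm, Finset.sum_congr rfl fun μ _ => hμ μ, Finset.sum_const, Finset.card_univ, Fintype.card_fin, nsmul_eq_mul]

omit [Fintype n] [DecidableEq n] [Nonempty n] in
/-- **MULTIPLICITY**: every fine bond lies in at most `2d` of the neighbourhoods `N(c)`: `Σ_c Σ_{b∈N(c)} g(b) ≤ 2d·Σ_b g(b)` for `g ≥ 0`. [folklore] -/
theorem sum_nbhd_le (g : PBond P j → ℝ) (hg : ∀ b, 0 ≤ g b) :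
    ∑ c : PBond P (j + 1), ∑ b ∈ univ.filter (fun b : PBond P j => blockOf b.src = c.src ∨ blockOf b.src = c.tgt), g b
      ≤ 2 * P.d * ∑ b : PBond P j, g b := by
  have hpt : ∀ c : PBond P (j + 1), ∑ b ∈ univ.filter (fun b : PBond P j => blockOf b.src = c.src ∨ blockOf b.src = c.tgt), g b
      ≤ ∑ b : PBond P j, ((if c.src = blockOf b.src then g b else 0) + (if c.tgt = blockOf b.src then g b else 0)) := by
    intro c
    rw [Finset.sum_filter]
    refine Finset.sum_le_sum fun b _ => ?_
    by_cases h1 : blockOf b.src = c.src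
    · rw [if_pos (Or.inl h1), if_pos h1.symm]; split_ifs <;> linarith [hg b]
    · by_cases h2 : blockOf b.src = c.tgt
      · rw [if_pos (Or.inr h2), if_neg (Ne.symm h1), if_pos h2.symm]; linarith
      · rw [if_neg (by tauto), if_neg (Ne.symm h1), if_neg (Ne.symm h2)]; linarith
  calc _ ≤ ∑ c : PBond P (j + 1), ∑ b : PBond P j, ((if c.src = blockOf b.src then g b else 0) + (if c.tgt = blockOf b.src then g b else 0)) :=
        Finset.sum_le_sum fun c _ => hpt c
    _ = ∑ b : PBond P j, ∑ c : PBond P (j + 1), ((if c.src = blockOf b.src then g b else 0) + (if c.tgt = blockOf b.src then g b else 0)) :=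
        Finset.sum_comm
    _ = ∑ b : PBond P j, 2 * P.d * g b := by
        refine Finset.sum_congr rfl fun b _ => ?_
        rw [Finset.sum_add_distrib, sum_ite_src_eq, sum_ite_tgt_eq]; ring
    _ = 2 * P.d * ∑ b : PBond P j, g b := by rw [Finset.mul_sum]

/-! ## §4 ★★ The `ℓ²` defect row -/

/-- ★ **POINTWISE DEFECT AGAINST THE NEIGHBOURHOOD SUM**: `‖T(V)Z(c) − P_{V̄}(CM_VZ)(c) − LINE_VZ(c)‖ ≤ 159·α·(d+2)L·S(c)`, `S(c) = Σ_{b∈N(c)}‖Z(b)‖`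
(✓ `norm_reduced_sub_line_le` with every walk mass bounded by §2). [cite: Balaban1985Averaging, Prop. 3 (124)-(126) p.36] -/
theorem norm_defect_le_nbhd (hj : j + 1 ≤ P.m + P.K) (V : GaugeField P j (Matrix.specialUnitaryGroup n ℂ)) (Z : PBond P j → Matrix n n ℂ)
    (c : PBond P (j + 1)) {α : ℝ} (hα : ∀ i : Idx P, dist1 (loopHol V c i) ≤ α) (hα24 : α ≤ 1 / 24) (hN : α < deltaSU n) :
    ‖(fderiv ℂ (eml : (Idx P → Matrix n n ℂ) → Matrix n n ℂ) (fun i => ((loopHol V c i : Matrix.specialUnitaryGroup n ℂ) : Matrix n n ℂ))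
          (fun i => covWalkSum V Z (walk (emb c.src) (loopWord P.L c.dir (off i.1) i.2.1 i.2.2))
            * ((loopHol V c i : Matrix.specialUnitaryGroup n ℂ) : Matrix n n ℂ))
          * star ((corr (expMeanLogSU (n := n)) V c : Matrix.specialUnitaryGroup n ℂ) : Matrix n n ℂ)
        + ((corr (expMeanLogSU (n := n)) V c : Matrix.specialUnitaryGroup n ℂ) : Matrix n n ℂ)
          * covWalkSum V Z (walk (emb c.src) (List.replicate P.L (c.dir, true)))
          * star ((corr (expMeanLogSU (n := n)) V c : Matrix.specialUnitaryGroup n ℂ) : Matrix n n ℂ))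
      - ((((Fintype.card (Idx P) : ℂ))⁻¹ • ∑ i : Idx P, covWalkSum V Z (walk (emb c.src) (stairWord i.2.1 (off i.1))))
          - ((avgFun (expMeanLogSU (n := n)) V c : Matrix.specialUnitaryGroup n ℂ) : Matrix n n ℂ)
              * (((Fintype.card (Idx P) : ℂ))⁻¹ • ∑ i : Idx P, covWalkSum V Z (walk (emb c.tgt) (stairWord i.2.1 (off i.1))))
              * star ((avgFun (expMeanLogSU (n := n)) V c : Matrix.specialUnitaryGroup n ℂ) : Matrix n n ℂ))
      - ((Fintype.card (Idx P) : ℂ))⁻¹ • ∑ i : Idx P,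
          ((holAt V (walk (emb c.src) (stairWord i.2.1 (off i.1))) : Matrix.specialUnitaryGroup n ℂ) : Matrix n n ℂ) *
            covWalkSum V Z (walk (walkEnd (emb c.src) (stairWord i.2.1 (off i.1))) (List.replicate P.L (c.dir, true))) *
          star ((holAt V (walk (emb c.src) (stairWord i.2.1 (off i.1))) : Matrix.specialUnitaryGroup n ℂ) : Matrix n n ℂ)‖
      ≤ 159 * α * ((((P.d + 2) * P.L : ℕ) : ℝ) * ∑ b ∈ univ.filter (fun b : PBond P j => blockOf b.src = c.src ∨ blockOf b.src = c.tgt), ‖Z b‖) :=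
  norm_reduced_sub_line_le V Z c (fun i => mass_loop_le hj Z c i) (mass_segment_le hj Z c) (fun σ r => mass_comb_tgt_le hj Z c σ r) hα hα24 hN

/-- ★★ **THE `ℓ²` DEFECT ROW OF ONE STEP**: if the (0.4) loop variables of `V` at EVERY coarse bond are within `α ≤ 1/24` (`α < δ_N`) of `1`, then
`Σ_c ‖T(V)Z(c) − P_{V̄}(CM_VZ)(c) − LINE_VZ(c)‖² ≤ (159·α·(d+2)L)²·(2dL^d)·(2d)·Σ_b ‖Z(b)‖²` — pointwise defect (★), Cauchy–Schwarz over the `≤ 2dL^d` bonds of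
`N(c)`, multiplicity `≤ 2d` (§3). [cite: Balaban1985Averaging, Prop. 3 (124)-(126) p.36] -/
theorem sum_normSq_defect_le (hj : j + 1 ≤ P.m + P.K) (V : GaugeField P j (Matrix.specialUnitaryGroup n ℂ)) (Z : PBond P j → Matrix n n ℂ)
    {α : ℝ} (hα : ∀ (c : PBond P (j + 1)) (i : Idx P), dist1 (loopHol V c i) ≤ α) (hα24 : α ≤ 1 / 24) (hN : α < deltaSU n) :
    ∑ c : PBond P (j + 1),
      ‖(fderiv ℂ (eml : (Idx P → Matrix n n ℂ) → Matrix n n ℂ) (fun i => ((loopHol V c i : Matrix.specialUnitaryGroup n ℂ) : Matrix n n ℂ))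
          (fun i => covWalkSum V Z (walk (emb c.src) (loopWord P.L c.dir (off i.1) i.2.1 i.2.2))
            * ((loopHol V c i : Matrix.specialUnitaryGroup n ℂ) : Matrix n n ℂ))
          * star ((corr (expMeanLogSU (n := n)) V c : Matrix.specialUnitaryGroup n ℂ) : Matrix n n ℂ)
        + ((corr (expMeanLogSU (n := n)) V c : Matrix.specialUnitaryGroup n ℂ) : Matrix n n ℂ)
          * covWalkSum V Z (walk (emb c.src) (List.replicate P.L (c.dir, true)))
          * star ((corr (expMeanLogSU (n := n)) V c : Matrix.specialUnitaryGroup n ℂ) : Matrix n n ℂ))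
      - ((((Fintype.card (Idx P) : ℂ))⁻¹ • ∑ i : Idx P, covWalkSum V Z (walk (emb c.src) (stairWord i.2.1 (off i.1))))
          - ((avgFun (expMeanLogSU (n := n)) V c : Matrix.specialUnitaryGroup n ℂ) : Matrix n n ℂ)
              * (((Fintype.card (Idx P) : ℂ))⁻¹ • ∑ i : Idx P, covWalkSum V Z (walk (emb c.tgt) (stairWord i.2.1 (off i.1))))
              * star ((avgFun (expMeanLogSU (n := n)) V c : Matrix.specialUnitaryGroup n ℂ) : Matrix n n ℂ))
      - ((Fintype.card (Idx P) : ℂ))⁻¹ • ∑ i : Idx P,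
          ((holAt V (walk (emb c.src) (stairWord i.2.1 (off i.1))) : Matrix.specialUnitaryGroup n ℂ) : Matrix n n ℂ) *
            covWalkSum V Z (walk (walkEnd (emb c.src) (stairWord i.2.1 (off i.1))) (List.replicate P.L (c.dir, true))) *
          star ((holAt V (walk (emb c.src) (stairWord i.2.1 (off i.1))) : Matrix.specialUnitaryGroup n ℂ) : Matrix n n ℂ)‖ ^ 2
      ≤ (159 * α * (((P.d + 2) * P.L : ℕ) : ℝ)) ^ 2 * (2 * P.d * (P.L : ℝ) ^ P.d) * (2 * P.d) * ∑ b : PBond P j, ‖Z b‖ ^ 2 := by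
  set K : ℝ := 159 * α * (((P.d + 2) * P.L : ℕ) : ℝ) with hK
  -- pointwise: `‖D(c)‖² ≤ K²·S(c)² ≤ K²·(2dL^d)·Σ_{N(c)}‖Z‖²`
  have hpt : ∀ c : PBond P (j + 1),
      ‖(fderiv ℂ (eml : (Idx P → Matrix n n ℂ) → Matrix n n ℂ) (fun i => ((loopHol V c i : Matrix.specialUnitaryGroup n ℂ) : Matrix n n ℂ))
          (fun i => covWalkSum V Z (walk (emb c.src) (loopWord P.L c.dir (off i.1) i.2.1 i.2.2))
            * ((loopHol V c i : Matrix.specialUnitaryGroup n ℂ) : Matrix n n ℂ))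
          * star ((corr (expMeanLogSU (n := n)) V c : Matrix.specialUnitaryGroup n ℂ) : Matrix n n ℂ)
        + ((corr (expMeanLogSU (n := n)) V c : Matrix.specialUnitaryGroup n ℂ) : Matrix n n ℂ)
          * covWalkSum V Z (walk (emb c.src) (List.replicate P.L (c.dir, true)))
          * star ((corr (expMeanLogSU (n := n)) V c : Matrix.specialUnitaryGroup n ℂ) : Matrix n n ℂ))
      - ((((Fintype.card (Idx P) : ℂ))⁻¹ • ∑ i : Idx P, covWalkSum V Z (walk (emb c.src) (stairWord i.2.1 (off i.1))))
          - ((avgFun (expMeanLogSU (n := n)) V c : Matrix.specialUnitaryGroup n ℂ) : Matrix n n ℂ)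
              * (((Fintype.card (Idx P) : ℂ))⁻¹ • ∑ i : Idx P, covWalkSum V Z (walk (emb c.tgt) (stairWord i.2.1 (off i.1))))
              * star ((avgFun (expMeanLogSU (n := n)) V c : Matrix.specialUnitaryGroup n ℂ) : Matrix n n ℂ))
      - ((Fintype.card (Idx P) : ℂ))⁻¹ • ∑ i : Idx P,
          ((holAt V (walk (emb c.src) (stairWord i.2.1 (off i.1))) : Matrix.specialUnitaryGroup n ℂ) : Matrix n n ℂ) *
            covWalkSum V Z (walk (walkEnd (emb c.src) (stairWord i.2.1 (off i.1))) (List.replicate P.L (c.dir, true))) *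
          star ((holAt V (walk (emb c.src) (stairWord i.2.1 (off i.1))) : Matrix.specialUnitaryGroup n ℂ) : Matrix n n ℂ)‖ ^ 2
        ≤ K ^ 2 * (2 * P.d * (P.L : ℝ) ^ P.d) * ∑ b ∈ univ.filter (fun b : PBond P j => blockOf b.src = c.src ∨ blockOf b.src = c.tgt), ‖Z b‖ ^ 2 := by
    intro c
    have h1 := norm_defect_le_nbhd hj V Z c (hα c) hα24 hN
    have hS0 : 0 ≤ ∑ b ∈ univ.filter (fun b : PBond P j => blockOf b.src = c.src ∨ blockOf b.src = c.tgt), ‖Z b‖ :=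
      Finset.sum_nonneg fun b _ => norm_nonneg _
    have hCS := sq_sum_le_card_mul_sum_sq (s := univ.filter (fun b : PBond P j => blockOf b.src = c.src ∨ blockOf b.src = c.tgt)) (f := fun b => ‖Z b‖)
    have hcard := card_nbhd_le (P := P) hj c
    have hsq0 : 0 ≤ ∑ b ∈ univ.filter (fun b : PBond P j => blockOf b.src = c.src ∨ blockOf b.src = c.tgt), ‖Z b‖ ^ 2 :=
      Finset.sum_nonneg fun b _ => sq_nonneg _
    calc _ ≤ (K * ∑ b ∈ univ.filter (fun b : PBond P j => blockOf b.src = c.src ∨ blockOf b.src = c.tgt), ‖Z b‖) ^ 2 := by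
          exact pow_le_pow_left₀ (norm_nonneg _) (h1.trans_eq (by rw [hK]; ring)) 2
      _ = K ^ 2 * (∑ b ∈ univ.filter (fun b : PBond P j => blockOf b.src = c.src ∨ blockOf b.src = c.tgt), ‖Z b‖) ^ 2 := by ring
      _ ≤ K ^ 2 * (((univ.filter fun b : PBond P j => blockOf b.src = c.src ∨ blockOf b.src = c.tgt).card : ℝ)
            * ∑ b ∈ univ.filter (fun b : PBond P j => blockOf b.src = c.src ∨ blockOf b.src = c.tgt), ‖Z b‖ ^ 2) :=
          mul_le_mul_of_nonneg_left hCS (sq_nonneg _)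
      _ ≤ K ^ 2 * ((2 * P.d * (P.L : ℝ) ^ P.d) * ∑ b ∈ univ.filter (fun b : PBond P j => blockOf b.src = c.src ∨ blockOf b.src = c.tgt), ‖Z b‖ ^ 2) :=
          mul_le_mul_of_nonneg_left (mul_le_mul_of_nonneg_right hcard hsq0) (sq_nonneg _)
      _ = _ := by ring
  -- sum over `c`, multiplicity `≤ 2d`
  calc _ ≤ ∑ c : PBond P (j + 1), K ^ 2 * (2 * P.d * (P.L : ℝ) ^ P.d)
          * ∑ b ∈ univ.filter (fun b : PBond P j => blockOf b.src = c.src ∨ blockOf b.src = c.tgt), ‖Z b‖ ^ 2 := Finset.sum_le_sum fun c _ => hpt c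
    _ = K ^ 2 * (2 * P.d * (P.L : ℝ) ^ P.d)
          * ∑ c : PBond P (j + 1), ∑ b ∈ univ.filter (fun b : PBond P j => blockOf b.src = c.src ∨ blockOf b.src = c.tgt), ‖Z b‖ ^ 2 := by
        rw [Finset.mul_sum]
    _ ≤ K ^ 2 * (2 * P.d * (P.L : ℝ) ^ P.d) * (2 * P.d * ∑ b : PBond P j, ‖Z b‖ ^ 2) :=
        mul_le_mul_of_nonneg_left (sum_nbhd_le (fun b => ‖Z b‖ ^ 2) fun b => sq_nonneg _) (by positivity)
    _ = K ^ 2 * (2 * P.d * (P.L : ℝ) ^ P.d) * (2 * P.d) * ∑ b : PBond P j, ‖Z b‖ ^ 2 := by ring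

end Summit.QuantumFields.YangMills.Theorems.Prop7TrueLinDefectBound

end
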